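import Summits.AnomalousDissipation.AnomalousDissipation.Theorems.TameRoughRigidityTameClosureTightLimit
import Summits.AnomalousDissipation.AnomalousDissipation.Theorems.TameRoughRigidityTameClosureCutoffTest
import Summits.AnomalousDissipation.AnomalousDissipation.Theorems.TameRoughRigidityTameClosureCutoffFlux
import Summits.AnomalousDissipation.AnomalousDissipation.Theorems.TameRoughRigidityTameClosureProjectedStress
import Summits.AnomalousDissipation.AnomalousDissipation.Theorems.TameRoughRigidityTameClosureCutoffAssembly
import Summits.AnomalousDissipation.AnomalousDissipation.Theorems.TameRoughRigidityTameClosureLimitExact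
import Summits.AnomalousDissipation.AnomalousDissipation.Theorems.EnsembleRigidityGPStatisticalRigidityDesaturation
import Summits.AnomalousDissipation.AnomalousDissipation.Theorems.MirrorStatisticsLoudTG.Negative.LoadBearing
import Literature.Analysis.FluidPDE.CylindricalGenerator
import Literature.Analysis.FluidPDE.StatisticalSolutionProofs
import Mathlib.MeasureTheory.Measure.Portmanteau
import HarnessLib

/-!
# Stub `stub_tameClosureK` (S2) of line `regimes`, crux `MirrorEnsemble.MirrorStatisticsLoudTG`
# (stmt-AnomalousDissipation-17693)

K-SUPPORTED TAME CLOSURE. At every energy level `E` and mean-enstrophy level `G₁`: if for every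
`r > 0` there is a Borel probability measure on `H = L²_σ(T³)` with integrable energy, mean energy
`≤ E`, mean enstrophy `≤ G₁`, CARRIED BY THE CLOSED MIRROR CLASS `closure (Fix K)` and with
Φ-uniform cylindrical forced-Euler defect `≤ r (∫ ‖∇Φ'(v)‖² dμ)^{1/2}` for the Taylor–Green force
`f_TG`, then `f_TG` carries an EXACT stationary statistical solution of forced Euler (FMRT Ch. IV
Def. 1.3 at `ν = 0`) with the same two bounds, still carried by `closure (Fix K)`.

The mathematics without the support clause is the landed crux `TameRoughRigidity.TameClosure`
(`Theorems/TameRoughRigidityTameClosure*.lean`: `stub_tightLimit`, `cutoffScheme_of_pieces`,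
`stub_limitExact`, `stub_symmetrise`, composed in `tameClosureSmooth_of_pieces` for every smooth
force). This file threads the support clause `μ (closure Fix K)ᶜ = 0` through that argument:

* `measure_eq_zero_of_forall_measure_eq_zero` — a weak limit of probability laws giving zero mass
  to an OPEN set gives it zero mass (portmanteau, Billingsley Thm. 2.1: rebuild the convergence in
  `ProbabilityMeasure H` from convergence against bounded continuous observables,
  `ProbabilityMeasure.tendsto_iff_forall_integral_tendsto`, then
  `ProbabilityMeasure.le_liminf_measure_open_of_tendsto`); applied to the open complement of the
  closed set `closure (Fix K)` on top of `stub_tightLimit` this is `tightLimitK`.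
* `neg_mem_mirrorClass`, `neg_mem_closure_mirrorClass` — `Fix K` (hence its closure) is invariant
  under `v ↦ −v`: the defining a.e. identities `v_{i'}(R_i x) = ∓ v_{i'}(x)` are linear, and a.e.
  identities transport along the Haar-measure-preserving reflections `R_i`
  (`measurePreserving_reflect`).
* `symmetriseK` — the time-reversal symmetrisation `μ' = ½(μ + (v ↦ −v)_*μ)` of `stub_symmetrise`
  (copied: its `∃` hides the witness) keeps the support, since `(v ↦ −v)⁻¹' (closure Fix K)ᶜ ⊆
  (closure Fix K)ᶜ`.
* `stub_tameClosureK` — the composition, verbatim the pattern `tameClosureSmooth_of_pieces` with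
  `f = f_TG` (smooth: `isSmooth_tgForce`) and the support threaded.

## References

* C. Foias, O. Manley, R. Rosa, R. Temam, *Navier–Stokes Equations and Turbulence*, CUP (2001),
  Ch. IV §1.2 Def. 1.3 (1.29)–(1.31); §3.1 Prop. 3.1; App. B.1–B.2. [FoiasManleyRosaTemam2001]
* P. Billingsley, *Convergence of Probability Measures*, 2nd ed., Thm. 2.1 (portmanteau),
  Thm. 5.1 (Prokhorov).
-/

set_option linter.dupNamespace false

noncomputable section

namespace Summit.AnomalousDissipation.AnomalousDissipation.Theorems.MirrorEnsembleMirrorStatisticsLoudTG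

open MeasureTheory Filter Topology
open scoped ENNReal InnerProductSpace RealInnerProductSpace NNReal
open Literature.Analysis.FunctionSpaces Literature.Analysis.FluidPDE
open Summit.AnomalousDissipation.AnomalousDissipation.Theorems.TaylorGreenLoudGalerkinStates.Negative (tgForce isSmooth_tgForce)
open Summit.AnomalousDissipation.AnomalousDissipation.Theorems.MirrorStatisticsLoudTG.Negative (mirrorClass memLp_tgForce measurePreserving_reflect)
open Summit.AnomalousDissipation.AnomalousDissipation.Theorems.TameRoughRigidity.TameClosure
  (stub_tightLimit stub_cutoffTest stub_cutoffFlux stub_projectedStress stub_cutoffAssembly stub_limitExact)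

/-- Local notation: the energy space `H` of `T³`. -/
local notation "H3" => Torus.energySpace (Fin 3)
/-- Local notation: `L²(T³; ℝ³)`. -/
local notation "L2" => (Lp (EuclideanSpace ℝ (Fin 3)) 2 (volume : Measure (UnitAddTorus (Fin 3))))
/-- Local notation: real vector fields on `T³`. -/
local notation "Vec3" => (UnitAddTorus (Fin 3)) → (EuclideanSpace ℝ (Fin 3))

/-! ### Weak limits keep null open sets -/

/-- **Portmanteau for null open sets.** If probability laws `μₙ` on `H` converge to the probability
law `μ'` against every bounded continuous real observable and every `μₙ` gives zero mass to the
open set `U`, then `μ' U = 0`: convergence against bounded continuous observables is weak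
convergence in `ProbabilityMeasure H` (`ProbabilityMeasure.tendsto_iff_forall_integral_tendsto`),
and `μ' U ≤ liminf μₙ U = 0` (`ProbabilityMeasure.le_liminf_measure_open_of_tendsto`;
Billingsley, Thm. 2.1). [folklore] -/
theorem measure_eq_zero_of_forall_measure_eq_zero {U : Set H3} (hU : IsOpen U)
    (μ : ℕ → Measure H3) (μ' : Measure H3) (hprob : ∀ n, IsProbabilityMeasure (μ n))
    (hprob' : IsProbabilityMeasure μ')
    (hweak : ∀ h : H3 → ℝ, Continuous h → (∃ C : ℝ, ∀ v, |h v| ≤ C) →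
      Tendsto (fun n => ∫ v, h v ∂(μ n)) atTop (𝓝 (∫ v, h v ∂μ')))
    (hz : ∀ n, μ n U = 0) : μ' U = 0 := by
  let P : ℕ → ProbabilityMeasure H3 := fun n => ⟨μ n, hprob n⟩
  let Q : ProbabilityMeasure H3 := ⟨μ', hprob'⟩
  have hPQ : Tendsto P atTop (𝓝 Q) := by
    refine ProbabilityMeasure.tendsto_iff_forall_integral_tendsto.2 fun g => ?_
    exact hweak g g.continuous ⟨‖g‖, fun v => by
      rw [← Real.norm_eq_abs]
      exact g.norm_coe_le_norm v⟩
  have h := ProbabilityMeasure.le_liminf_measure_open_of_tendsto hPQ hU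
  have h0 : atTop.liminf (fun i => ((P i : ProbabilityMeasure H3) : Measure H3) U) = 0 := by
    rw [show (fun i => ((P i : ProbabilityMeasure H3) : Measure H3) U) = fun _ => (0 : ℝ≥0∞) from
      funext hz]
    exact liminf_const 0
  exact nonpos_iff_eq_zero.1 (h.trans h0.le)

/-- **S1 with support (`tightLimitK`)** — TIGHT LIMIT IN THE K-SUPPORTED TAME CLASS. A sequence of
Borel probability measures on `H` with integrable energy, mean energy `≤ E`, mean enstrophy `≤ G₁`
and carried by `closure (Fix K)` has a subsequence converging against every bounded continuous
observable to a Borel probability measure with integrable energy, mean energy `≤ E`, mean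
enstrophy `≤ G₁`, carried by `closure (Fix K)`: the landed `stub_tightLimit` (Markov + Rellich +
Prokhorov + lsc bounds) and the open-set portmanteau inequality on the open complement of the
closed set `closure (Fix K)`. FMRT 2001, Ch. IV §3.1 Prop. 3.1; Billingsley, Thms. 2.1, 5.1.
[folklore] -/
theorem tightLimitK (E G₁ : ℝ) (μ : ℕ → Measure H3)
    (hprob : ∀ n, IsProbabilityMeasure (μ n))
    (hint : ∀ n, Integrable (fun v : H3 => ‖v‖ ^ 2) (μ n))
    (hE : ∀ n, Torus.ensembleEnergy (μ n) ≤ E)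
    (hG : ∀ n, Torus.ensembleEnstrophy (μ n) ≤ ENNReal.ofReal G₁)
    (hS : ∀ n, μ n (closure mirrorClass)ᶜ = 0) :
    ∃ φ : ℕ → ℕ, StrictMono φ ∧ ∃ μ' : Measure H3, IsProbabilityMeasure μ' ∧
      Integrable (fun v : H3 => ‖v‖ ^ 2) μ' ∧ Torus.ensembleEnergy μ' ≤ E ∧
      Torus.ensembleEnstrophy μ' ≤ ENNReal.ofReal G₁ ∧ μ' (closure mirrorClass)ᶜ = 0 ∧
      ∀ h : H3 → ℝ, Continuous h → (∃ C : ℝ, ∀ v, |h v| ≤ C) →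
        Tendsto (fun n => ∫ v, h v ∂(μ (φ n))) atTop (𝓝 (∫ v, h v ∂μ')) := by
  obtain ⟨φ, hφ, μ', hprob', hint', hE', hG', hweak⟩ := stub_tightLimit E G₁ μ hprob hint hE hG
  exact ⟨φ, hφ, μ', hprob', hint', hE', hG',
    measure_eq_zero_of_forall_measure_eq_zero isClosed_closure.isOpen_compl (fun n => μ (φ n)) μ'
      (fun n => hprob (φ n)) hprob' hweak fun n => hS (φ n), hweak⟩

/-! ### The mirror class is invariant under `v ↦ −v` -/

/-- **`Fix K` is symmetric under `v ↦ −v`.** The defining identities `v_{i'}(R_i x) = ∓ v_{i'}(x)`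
a.e. are linear in `v`; the representative of `−v` is `−v` a.e. (`Lp.coeFn_neg`), also along the
Haar-measure-preserving reflections `R_i` (`measurePreserving_reflect`,
`QuasiMeasurePreserving.ae`). [folklore] -/
theorem neg_mem_mirrorClass {v : H3} (hv : v ∈ mirrorClass) : -v ∈ mirrorClass := by
  intro i i'
  have hneg : ∀ᵐ x ∂(volume : Measure (UnitAddTorus (Fin 3))),
      (((-v : H3) : L2) : Vec3) x = -(((v : H3) : L2) : Vec3) x := by
    rw [Submodule.coe_neg]
    exact Lp.coeFn_neg _
  have hneg' : ∀ᵐ x ∂(volume : Measure (UnitAddTorus (Fin 3))),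
      (((-v : H3) : L2) : Vec3) (Function.update x i (-x i)) =
        -(((v : H3) : L2) : Vec3) (Function.update x i (-x i)) :=
    (measurePreserving_reflect i).quasiMeasurePreserving.ae hneg
  filter_upwards [hv i i', hneg, hneg'] with x hx hn hn'
  rw [hn', PiLp.neg_apply, hx, hn, PiLp.neg_apply]
  split_ifs <;> rfl

/-- **`closure (Fix K)` is symmetric under `v ↦ −v`**: negation is continuous and maps `Fix K`
into itself (`map_mem_closure`). [folklore] -/
theorem neg_mem_closure_mirrorClass {v : H3} (hv : v ∈ closure mirrorClass) :
    -v ∈ closure mirrorClass :=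
  map_mem_closure continuous_neg hv fun _ h => neg_mem_mirrorClass h

/-! ### Time-reversal symmetrisation keeping the support -/

/-- The work functional is odd: `(−v, g) = −(v, g)` for `g ∈ L²` (re-proved here; the copies in
the pattern files `TameRoughRigidityTameClosureSymmetrise` /
`EnsembleRigidityGPStatisticalRigidityDesaturation` are private). [folklore] -/
private theorem symmetriseK_pairing_neg {g : Vec3} (hg : MemLp g 2 volume) (v : H3) :
    Torus.pairing (((-v : H3) : L2)) g = -Torus.pairing ((v : H3) : L2) g := by
  -- adapted from `GPStatisticalRigidity.desaturation_pairing_neg`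
  rw [Submodule.coe_neg, Torus.pairing_eq_inner hg, Torus.pairing_eq_inner hg, inner_neg_left]

/-- **S4 with support (`symmetriseK`)** — TIME-REVERSAL NORMAL FORM OF A K-SUPPORTED LIMIT. For a
smooth force `f`, a Borel probability measure on `H` with integrable energy `≤ E`, mean enstrophy
`≤ G₁`, carried by `closure (Fix K)` and with the EXACT cylindrical Liouville identity
`∫ ⟨f − B(v,v), Φ'(v)⟩ dμ = 0` (all cylindrical `Φ`) yields a stationary statistical solution of
the Euler equations forced by `f` in the FMRT class with the same bounds, still carried by
`closure (Fix K)`: the symmetrised measure `μ' = ½(μ + (v ↦ −v)_*μ)` of the landed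
`stub_symmetrise` (same energy and enstrophy, `desaturation_eGradNormSq_neg`; same identity,
`desaturation_generator_neg_left/right`, `desaturation_exists_reflect`; ZERO work on every energy
shell, which at `ν = 0` is the shell inequality (1.31)), plus
`(v ↦ −v)⁻¹' (closure Fix K)ᶜ ⊆ (closure Fix K)ᶜ` (`neg_mem_closure_mirrorClass`).
[FoiasManleyRosaTemam2001, Ch. IV §1.2 Def. 1.3 (1.29)–(1.31)] -/
theorem symmetriseK (f : Vec3) (hf : Torus.IsSmooth f) (E G₁ : ℝ) (μ : Measure H3)
    (hprob : IsProbabilityMeasure μ) (hint : Integrable (fun v : H3 => ‖v‖ ^ 2) μ)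
    (hE : Torus.ensembleEnergy μ ≤ E) (hG : Torus.ensembleEnstrophy μ ≤ ENNReal.ofReal G₁)
    (hS : μ (closure mirrorClass)ᶜ = 0)
    (hgen : ∀ Φ : Torus.CylindricalTest (Fin 3),
      Integrable (fun v : H3 => Torus.nsGeneratorPairing 0 f v (Φ.grad v)) μ ∧
        ∫ v, Torus.nsGeneratorPairing 0 f v (Φ.grad v) ∂μ = 0) :
    ∃ μ' : Measure H3, Torus.IsStationaryStatisticalSolution 0 f μ' ∧
      Integrable (fun v : H3 => ‖v‖ ^ 2) μ' ∧ Torus.ensembleEnergy μ' ≤ E ∧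
      Torus.ensembleEnstrophy μ' ≤ ENNReal.ofReal G₁ ∧ μ' (closure mirrorClass)ᶜ = 0 := by
  -- adapted from `TameRoughRigidity.TameClosure.stub_symmetrise` (support clause threaded)
  haveI := hprob
  have hf2 : MemLp f 2 volume := hf.memLp 2
  -- the reflection `T` and the push-forward `ν = T_* μ`
  have hTa : ∀ v : H3, MeasurableEquiv.neg H3 v = -v := fun v => by simp
  set ν : Measure H3 := μ.map (MeasurableEquiv.neg H3) with hν
  haveI : IsProbabilityMeasure ν :=
    Measure.isProbabilityMeasure_map (MeasurableEquiv.neg H3).measurable.aemeasurable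
  have hIν : ∀ g : H3 → ℝ, ∫ v, g v ∂ν = ∫ v, g (-v) ∂μ := fun g => by
    rw [hν, integral_map_equiv]
    simp only [hTa]
  have hIntν : ∀ g : H3 → ℝ, Integrable (fun v => g (-v)) μ → Integrable g ν := fun g hg => by
    rw [hν]
    refine (integrable_map_equiv _ g).2 ?_
    simpa only [Function.comp_def, hTa] using hg
  -- the symmetrised measure `μ' = ½ (μ + ν)`
  set μ' : Measure H3 := (2⁻¹ : ℝ≥0∞) • (μ + ν) with hμ'
  have h2 : (2⁻¹ : ℝ≥0∞) * 2 = 1 := ENNReal.inv_mul_cancel two_ne_zero ENNReal.ofNat_ne_top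
  have hprob' : IsProbabilityMeasure μ' := ⟨by
    rw [hμ', Measure.smul_apply, Measure.add_apply, measure_univ, measure_univ, smul_eq_mul,
      one_add_one_eq_two, h2]⟩
  have hInt' : ∀ g : H3 → ℝ, Integrable g μ → Integrable g ν → Integrable g μ' :=
    fun g h1 h2 => by
    rw [hμ']
    exact (h1.add_measure h2).smul_measure (ENNReal.inv_ne_top.2 two_ne_zero)
  have hI : ∀ g : H3 → ℝ, Integrable g μ → Integrable g ν →
      ∫ v, g v ∂μ' = 2⁻¹ * ((∫ v, g v ∂μ) + ∫ v, g (-v) ∂μ) := fun g hgμ hgν => by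
    rw [hμ', integral_smul_measure, integral_add_measure hgμ hgν, hIν, smul_eq_mul,
      ENNReal.toReal_inv, ENNReal.toReal_ofNat]
  -- support: `T⁻¹' (closure Fix K)ᶜ ⊆ (closure Fix K)ᶜ`
  have hSν : ν (closure mirrorClass)ᶜ = 0 := by
    rw [hν, Measure.map_apply (MeasurableEquiv.neg H3).measurable
      isClosed_closure.measurableSet.compl]
    refine measure_mono_null (fun v hv => ?_) hS
    simp only [Set.mem_preimage, Set.mem_compl_iff, hTa] at hv ⊢
    exact fun h => hv (neg_mem_closure_mirrorClass h)
  have hS' : μ' (closure mirrorClass)ᶜ = 0 := by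
    rw [hμ', Measure.smul_apply, Measure.add_apply, hS, hSν, add_zero, smul_zero]
  -- energy
  have hintν : Integrable (fun v : H3 => ‖v‖ ^ 2) ν :=
    hIntν _ (by simpa only [norm_neg] using hint)
  have hint' : Integrable (fun v : H3 => ‖v‖ ^ 2) μ' := hInt' _ hint hintν
  have hE' : Torus.ensembleEnergy μ' ≤ E := by
    have h1 : Torus.ensembleEnergy μ' = Torus.ensembleEnergy μ := by
      unfold Torus.ensembleEnergy
      rw [hI _ hint hintν]
      simp only [norm_neg]
      ring
    exact h1 ▸ hE
  -- enstrophy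
  have hGeq : Torus.ensembleEnstrophy μ' = Torus.ensembleEnstrophy μ := by
    unfold Torus.ensembleEnstrophy
    rw [hμ', lintegral_smul_measure, lintegral_add_measure, hν, lintegral_map_equiv]
    simp only [hTa, EnsembleRigidity.GPStatisticalRigidity.desaturation_eGradNormSq_neg,
      smul_eq_mul]
    rw [← two_mul, ← mul_assoc, h2, one_mul]
  have hG' : Torus.ensembleEnstrophy μ' ≤ ENNReal.ofReal G₁ := hGeq ▸ hG
  -- zero shell work
  have hP : Integrable (fun v : H3 => Torus.pairing (v : L2) f) μ := by
    refine Integrable.mono' ((hint.add (integrable_const 1)).const_mul ‖hf2.toLp f‖)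
      (Torus.continuous_pairing_coe hf2).aestronglyMeasurable (ae_of_all _ fun v => ?_)
    rw [Real.norm_eq_abs]
    refine (Torus.abs_pairing_coe_le hf2 v).trans ?_
    simp only [Pi.add_apply]
    nlinarith [mul_nonneg (norm_nonneg (hf2.toLp f)) (sq_nonneg (‖v‖ - 1)),
      mul_nonneg (norm_nonneg (hf2.toLp f)) (norm_nonneg v)]
  have hPν : Integrable (fun v : H3 => Torus.pairing (v : L2) f) ν :=
    hIntν _ (by simpa only [symmetriseK_pairing_neg hf2] using hP.fun_neg)
  have hshell : ∀ e₁ e₂ : ℝ≥0∞, e₁ < e₂ →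
      ∫ v in {v : H3 | e₁ ≤ ‖v‖ₑ ^ 2 ∧ ‖v‖ₑ ^ 2 < e₂}, Torus.pairing (v : L2) f ∂μ' = 0 := by
    intro e₁ e₂ _
    have hpre : (MeasurableEquiv.neg H3) ⁻¹' {v : H3 | e₁ ≤ ‖v‖ₑ ^ 2 ∧ ‖v‖ₑ ^ 2 < e₂} =
        {v : H3 | e₁ ≤ ‖v‖ₑ ^ 2 ∧ ‖v‖ₑ ^ 2 < e₂} := by
      ext v
      simp only [Set.mem_preimage, Set.mem_setOf_eq, hTa, enorm_neg]
    rw [hμ', Measure.restrict_smul, Measure.restrict_add, integral_smul_measure,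
      integral_add_measure hP.restrict hPν.restrict, hν, setIntegral_map_equiv, hpre]
    simp only [hTa, symmetriseK_pairing_neg hf2, integral_neg, add_neg_cancel, smul_zero]
  -- the exact Liouville identity transfers
  have hgen' : ∀ Φ : Torus.CylindricalTest (Fin 3),
      Integrable (fun v : H3 => Torus.nsGeneratorPairing 0 f v (Φ.grad v)) μ' ∧
        ∫ v, Torus.nsGeneratorPairing 0 f v (Φ.grad v) ∂μ' = 0 := by
    intro Φ
    obtain ⟨Ψ, hΨ⟩ := EnsembleRigidity.GPStatisticalRigidity.desaturation_exists_reflect Φ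
    have hgn : ∀ v : H3, Torus.nsGeneratorPairing 0 f (-v) (Φ.grad (-v)) =
        -Torus.nsGeneratorPairing 0 f v (Ψ.grad v) := fun v => by
      rw [hΨ, EnsembleRigidity.GPStatisticalRigidity.desaturation_generator_neg_right, neg_neg,
        EnsembleRigidity.GPStatisticalRigidity.desaturation_generator_neg_left]
    obtain ⟨hLμ, hzμ⟩ := hgen Φ
    obtain ⟨hLΨ, hzΨ⟩ := hgen Ψ
    have hLν : Integrable (fun v : H3 => Torus.nsGeneratorPairing 0 f v (Φ.grad v)) ν := by
      refine hIntν _ ?_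
      simp_rw [hgn]
      exact hLΨ.fun_neg
    refine ⟨hInt' _ hLμ hLν, ?_⟩
    rw [hI _ hLμ hLν]
    simp_rw [hgn, integral_neg, hzμ, hzΨ]
    norm_num
  -- assemble the FMRT stationary statistical solution
  refine ⟨μ', ⟨hprob', ?_, hgen', ?_⟩, hint', hE', hG', hS'⟩
  · -- finite mean enstrophy
    change Torus.ensembleEnstrophy μ' < ⊤
    exact hG'.trans_lt ENNReal.ofReal_lt_top
  · -- the shell energy inequality at `ν = 0`: zero work
    intro e₁ e₂ hlt
    simp only [zero_mul, zero_sub]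
    rw [integral_neg, hshell e₁ e₂ hlt, neg_zero]

/-! ### The stub -/

/-- **S2 `stub_tameClosureK`** — K-SUPPORTED TAME CLOSURE at the Taylor–Green force: at every
energy level `E` and mean-enstrophy level `G₁`, if K-supported tame near-statistics of forced
Euler (probability, integrable energy `≤ E`, mean enstrophy `≤ G₁`, carried by `closure Fix K`,
cylindrical defect `≤ r`) exist for every `r > 0`, then an exact K-supported stationary
statistical solution of Euler forced by `f_TG` with the same bounds exists. Proof = the pattern
`tameClosureSmooth_of_pieces` with the support threaded: approximants `μₙ` at defect radius
`1/(n+1)`; `tightLimitK` gives a subsequence and a K-supported tame weak limit `μ'`; for each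
cylindrical `Φ`, `stub_limitExact` — with `F = L₀Φ` (continuous with quadratic growth,
`Torus.continuous_nsGeneratorPairing_grad`, `Torus.exists_abs_nsGeneratorPairing_grad_le`) and
the Galerkin cut-off scheme `cutoffScheme_of_pieces` (f_TG smooth: `isSmooth_tgForce`) on `μ'`
and on the `μ_{φ n}`, the eventual clause firing once `1/(φ n + 1) ≤ δ` — gives the exact
Liouville identity of `μ'`; `symmetriseK` turns `μ'` into a K-supported FMRT stationary
statistical solution with the same bounds.
[FoiasManleyRosaTemam2001, Ch. IV §1.2 Def. 1.3, §3.1 Prop. 3.1, App. B.1–B.2] -/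
theorem stub_tameClosureK :
    ∀ E G₁ : ℝ,
      (∀ r : ℝ, 0 < r → ∃ μ : Measure H3, IsProbabilityMeasure μ ∧
        Integrable (fun v : H3 => ‖v‖ ^ 2) μ ∧ Torus.ensembleEnergy μ ≤ E ∧
        Torus.ensembleEnstrophy μ ≤ ENNReal.ofReal G₁ ∧ μ (closure mirrorClass)ᶜ = 0 ∧
        (∀ Φ : Torus.CylindricalTest (Fin 3),
          Integrable (fun v : H3 => Torus.nsGeneratorPairing 0 tgForce v (Φ.grad v)) μ ∧
            |∫ v, Torus.nsGeneratorPairing 0 tgForce v (Φ.grad v) ∂μ| ≤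
              r * Real.sqrt (∫ v, Torus.gradNormSq (Φ.grad v) ∂μ))) →
      ∃ μ : Measure H3, Torus.IsStationaryStatisticalSolution 0 tgForce μ ∧
        Integrable (fun v : H3 => ‖v‖ ^ 2) μ ∧ Torus.ensembleEnergy μ ≤ E ∧
        Torus.ensembleEnstrophy μ ≤ ENNReal.ofReal G₁ ∧ μ (closure mirrorClass)ᶜ = 0 := by
  intro E G₁ hnear
  have hfs : Torus.IsSmooth tgForce := isSmooth_tgForce
  -- approximants at defect radius `1/(n+1)`
  have hex : ∀ n : ℕ, ∃ μ : Measure H3, IsProbabilityMeasure μ ∧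
      Integrable (fun v : H3 => ‖v‖ ^ 2) μ ∧ Torus.ensembleEnergy μ ≤ E ∧
      Torus.ensembleEnstrophy μ ≤ ENNReal.ofReal G₁ ∧ μ (closure mirrorClass)ᶜ = 0 ∧
      (∀ Φ : Torus.CylindricalTest (Fin 3),
        Integrable (fun v : H3 => Torus.nsGeneratorPairing 0 tgForce v (Φ.grad v)) μ ∧
          |∫ v, Torus.nsGeneratorPairing 0 tgForce v (Φ.grad v) ∂μ| ≤
            (1 / ((n : ℝ) + 1)) * Real.sqrt (∫ v, Torus.gradNormSq (Φ.grad v) ∂μ)) :=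
    fun n => hnear (1 / ((n : ℝ) + 1)) (by positivity)
  choose μ hμ using hex
  -- S1 with support: a K-supported tame weak limit along a subsequence
  obtain ⟨φ, hφ, μ', hprob', hint', hE', hG', hS', hweak⟩ :=
    tightLimitK E G₁ μ (fun n => (hμ n).1) (fun n => (hμ n).2.1) (fun n => (hμ n).2.2.1)
      (fun n => (hμ n).2.2.2.1) (fun n => (hμ n).2.2.2.2.1)
  -- S3 fed by S2: the exact cylindrical Liouville identity of the limit
  have hgen : ∀ Φ : Torus.CylindricalTest (Fin 3),
      Integrable (fun v : H3 => Torus.nsGeneratorPairing 0 tgForce v (Φ.grad v)) μ' ∧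
        ∫ v, Torus.nsGeneratorPairing 0 tgForce v (Φ.grad v) ∂μ' = 0 := by
    intro Φ
    obtain ⟨A, -, hA⟩ := Torus.exists_abs_nsGeneratorPairing_grad_le 0 (hfs.memLp 2) Φ
    refine stub_limitExact (fun n => μ (φ n)) μ' (fun n => (hμ (φ n)).1) hprob' hweak hint'
      (fun v => Torus.nsGeneratorPairing 0 tgForce v (Φ.grad v))
      (Torus.continuous_nsGeneratorPairing_grad 0 ((hfs.memLp 2).integrable one_le_two) Φ) A hA ?_
    intro ε hε
    obtain ⟨ρ₀, hρ₀⟩ :=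
      stub_cutoffAssembly stub_cutoffTest stub_cutoffFlux stub_projectedStress tgForce hfs Φ E G₁ ε hε
    refine ⟨ρ₀, fun ρ hρ => ?_⟩
    obtain ⟨c, h, Ψ, δ, hδ, hc, hh, hc01, hc1, hhb, hclass⟩ := hρ₀ ρ hρ
    refine ⟨c, h, hc, hh, hc01, hc1, hhb, (hclass μ' hprob' hint' hE' hG').1, fun n =>
      (hclass (μ (φ n)) (hμ (φ n)).1 (hμ (φ n)).2.1 (hμ (φ n)).2.2.1 (hμ (φ n)).2.2.2.1).1, ?_⟩
    -- eventually the defect radius `1/(φ n + 1)` is below `δ`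
    obtain ⟨N, hN⟩ := exists_nat_gt (1 / δ)
    refine Filter.eventually_atTop.2 ⟨N, fun n hn => ?_⟩
    have hμn := hμ (φ n)
    refine (hclass (μ (φ n)) hμn.1 hμn.2.1 hμn.2.2.1 hμn.2.2.2.1).2 ?_
    obtain ⟨-, hdef⟩ := hμn.2.2.2.2.2 Ψ
    refine hdef.trans (mul_le_mul_of_nonneg_right ?_ (Real.sqrt_nonneg _))
    have h1 : (N : ℝ) ≤ (φ n : ℝ) := Nat.cast_le.2 (hn.trans (hφ.id_le n))
    have hpos : (0 : ℝ) < (φ n : ℝ) + 1 := by positivity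
    have h2 : 1 / δ < (φ n : ℝ) + 1 := by linarith
    have h3 : 1 < ((φ n : ℝ) + 1) * δ := (div_lt_iff₀ hδ).1 h2
    rw [div_le_iff₀ hpos]
    linarith [h3, mul_comm ((φ n : ℝ) + 1) δ]
  -- S4 with support: symmetrise the limit into a K-supported FMRT stationary statistical solution
  exact symmetriseK tgForce hfs E G₁ μ' hprob' hint' hE' hG' hS' hgen

end Summit.AnomalousDissipation.AnomalousDissipation.Theorems.MirrorEnsembleMirrorStatisticsLoudTG

end
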